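import Summits.CriticalPhenomena.Ising3DConformalLimit.Theorems.GapForcesFarMerging.Negative.LineFamily

/-!
# `GapForcesFarMerging`: the line `rp-unpinch-single-passage` is soft except at quasi-multiplicativity, III

Part 3/4 — THE VERDICTS FOR FAMILY A′ and the no-go theorem for stub 4: A′ satisfies the
single-pinch law with `κ' = 2` (`singlePinchLawShape_A'`), STRICT single-pinch positivity
(`singlePinchPositiveShape_A'`), the un-pinched envelope (`unpinchedEnvelopeShape_A'`), the isosceles
RP minors (`rpUnpinchIsoShape_A'`: `(2q⁴)² ≤ 2q⁴·2q²(1−r)`, `r ≤ 1/2`), and VIOLATES one-passage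
quasi-multiplicativity (`not_quasiMultiplicativeShape_A'`: `𝒜(e₂;m) = 2q_m² → 0` against
`𝒜(e₂;2)𝒜(2e₂;m) ≥ 2/25`). Hence **`quasiMultiplicative_false_without_model`**: no argument from the
22-field soft package + GAP + isosceles RP minors + envelope + single-pinch law + strict positivity
proves `QuasiMultiplicative` — any proof of stub 4 must use a property of `criticalCorr 3` beyond
them (a lattice coupling between the pinched and the opened configuration); and
`lineInputs_without_QM_and_farMerging` packages the witness (which also has no far merging).

## References

* M. Aizenman, Comm. Math. Phys. 86 (1982) 1–48, §§4–5 [AizenmanCMP1982].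
* M. Aizenman, H. Duminil-Copin, Ann. Math. 194 (2021), §3 eqs. (3.7), (3.11)–(3.12), §5.1 eq. (5.3)
  [AizenmanDuminilCopinAnnals2021].
* J. Fröhlich, R. Israel, E. H. Lieb, B. Simon, Comm. Math. Phys. 62 (1978) 1–34, Thm. 2.1 [FILS1978].
* G. F. Lawler, Intersections of Random Walks (1991), ch. 3–5 [Lawler1991].
-/

noncomputable section

namespace Summit.CriticalPhenomena.Ising3DConformalLimit.Theorems.GapForcesFarMerging.Negative

open Literature.Probability.LatticeModels

/-! ## Verdicts for family A′ on the five stub shapes -/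

section verdicts

/-- `T₀(xR m) = q m`. [folklore] -/
theorem T₀_xR {m : ℕ} (hm : 1 ≤ m) : T₀ (xR m) = q m := by
  rw [T₀, S₀_zero_left, (evals_x hm).1]

/-- **A′ satisfies the single-pinch law** with `κ' = 2`, `C = 2` (`T_{A′}(e₂;m) = 2q⁴`, `q ≤ 1/(2m)`). [folklore] -/
theorem singlePinchLawShape_A' : SinglePinchLawShape S₀ T₀ FA' := by
  refine ⟨2, 2, two_pos, fun m hm => ?_⟩
  show FA' ![0, e₂, up m, dn m] - S₀ 0 e₂ * S₀ (up m) (dn m) ≤ 2 * (2 * (m : ℝ)) ^ (-(2 : ℝ)) * T₀ (xR m) ^ 2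
  rw [TS_w hm, T₀_xR hm]
  have hm1 := one_le_m hm
  have hpow : (2 * (m : ℝ)) ^ (-(2 : ℝ)) = ((2 * (m : ℝ)) ^ 2)⁻¹ := by
    rw [Real.rpow_neg (by positivity), Real.rpow_two]
  rw [hpow]
  have hq : q m ≤ (2 * (m : ℝ))⁻¹ := by rw [q]; exact inv_anti₀ (by positivity) (by linarith)
  have hq0 := (q_pos m).le
  have h2 : q m * q m ≤ ((2 * (m : ℝ)) ^ 2)⁻¹ := by
    rw [sq, mul_inv]; exact mul_le_mul hq hq hq0 (by positivity)
  nlinarith [mul_nonneg hq0 hq0]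

/-- **A′ has a strictly positive single-pinch truncation** at every scale. [folklore] -/
theorem singlePinchPositiveShape_A' : SinglePinchPositiveShape S₀ FA' := fun m hm => by
  show 0 < FA' ![0, e₂, up m, dn m] - S₀ 0 e₂ * S₀ (up m) (dn m)
  rw [TS_w hm]; have := q_pos m; positivity

/-- `0 ≤ (1-q²)/(2m) ≤ 1/2`. [folklore] -/
theorem r_bounds {m : ℕ} (hm : 1 ≤ m) :
    0 ≤ (2 * (m : ℝ))⁻¹ * (1 - q m * q m) ∧ (2 * (m : ℝ))⁻¹ * (1 - q m * q m) ≤ 1 / 2 := by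
  have hm1 := one_le_m hm
  have hq0 := q_pos m
  have hq := q_le_half hm
  have h1 : (2 * (m : ℝ))⁻¹ ≤ 1 / 2 := by rw [one_div]; exact inv_anti₀ (by norm_num) (by linarith)
  have h0 : 0 ≤ (2 * (m : ℝ))⁻¹ := by positivity
  constructor
  · exact mul_nonneg h0 (by nlinarith)
  · calc (2 * (m : ℝ))⁻¹ * (1 - q m * q m) ≤ (1 / 2) * 1 :=
        mul_le_mul h1 (by nlinarith) (by nlinarith) (by norm_num)
      _ = 1 / 2 := by ring

/-- **A′ satisfies the un-pinched envelope** `0 ≤ · ≤ 2T(xR m)²`. [folklore] -/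
theorem unpinchedEnvelopeShape_A' : UnpinchedEnvelopeShape S₀ T₀ FA' := fun m hm => by
  show 0 ≤ FA' ![Pi.single 1 (m : ℤ), Pi.single 1 (-(m : ℤ)), up m, dn m] -
      S₀ (Pi.single 1 (m : ℤ)) (Pi.single 1 (-(m : ℤ))) * S₀ (up m) (dn m) ∧
    FA' ![Pi.single 1 (m : ℤ), Pi.single 1 (-(m : ℤ)), up m, dn m] -
      S₀ (Pi.single 1 (m : ℤ)) (Pi.single 1 (-(m : ℤ))) * S₀ (up m) (dn m) ≤ 2 * T₀ (xR m) ^ 2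
  rw [pairpair_u hm, T₀_xR hm]
  obtain ⟨h0, h1⟩ := r_bounds hm
  have hq0 := q_pos m
  constructor
  · exact mul_nonneg (by positivity) (by linarith)
  · nlinarith [mul_pos hq0 hq0]

/-- **A′ satisfies the isosceles RP minors** — every instance of `RPUnpinch` that the skeleton's
proved glue `gapGivesSinglePinch` consumes: `(2q⁴)² ≤ 2q⁴ · 2q²(1 - r)`, `r ≤ 1/2`. [folklore] -/
theorem rpUnpinchIsoShape_A' : RPUnpinchIsoShape S₀ FA' := fun m hm => by
  show (FA' ![0, e₂, up m, dn m] - S₀ 0 e₂ * S₀ (up m) (dn m)) ^ 2 ≤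
    (FA' ![0, e₂, xR m, xR m + e₂] - S₀ 0 e₂ * S₀ (xR m) (xR m + e₂)) *
      (FA' ![Pi.single 1 (m : ℤ), Pi.single 1 (-(m : ℤ)), up m, dn m] -
        S₀ (Pi.single 1 (m : ℤ)) (Pi.single 1 (-(m : ℤ))) * S₀ (up m) (dn m))
  rw [TS_w hm, gapq_x hm, pairpair_u hm]
  obtain ⟨h0, h1⟩ := r_bounds hm
  set Q := q m * q m with hQ
  have hQ0 : 0 < Q := mul_pos (q_pos m) (q_pos m)
  have hQ4 : Q ≤ 1 / 4 := by have := q_le_half hm; have := q_pos m; rw [hQ]; nlinarith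
  have hA : (2 * Q ^ 2) ^ 2 ≤ 2 * Q ^ 3 := by nlinarith [pow_pos hQ0 3]
  have hB : 2 * Q ^ 3 ≤ 2 * Q ^ 2 * (2 * Q * (1 - (2 * (m : ℝ))⁻¹ * (1 - Q))) := by
    nlinarith [pow_pos hQ0 3]
  exact hA.trans hB

/-- The three avoidance values of A′ used against quasi-multiplicativity. [folklore] -/
theorem avoid_w {m : ℕ} (hm : 1 ≤ m) : avoidS S₀ FA' e₂ m = 2 * (q m * q m) := by
  unfold avoidS TS NparS pairCovS
  rw [TS_w hm, Npar_w hm]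
  have := q_pos m
  field_simp

/-- `𝒜_{A′}(src s; m) = 2(1 - (1-q²)/s)`. [folklore] -/
theorem avoid_v {m s : ℕ} (hm : 1 ≤ m) (hs : 1 ≤ s) (hsm : s ≤ m) :
    avoidS S₀ FA' (src s) m = 2 * (1 - (s : ℝ)⁻¹ * (1 - q m * q m)) := by
  unfold avoidS TS NparS pairCovS
  rw [TS_v hm hs hsm, Npar_v hm hs hsm]
  have := q_pos m
  field_simp

/-- **A′ violates one-passage quasi-multiplicativity**: `𝒜(e₂;m) = 2q_m² → 0` while
`𝒜(e₂;2)·𝒜(2e₂;m) ≥ 2/25`. [folklore] -/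
theorem not_quasiMultiplicativeShape_A' : ¬ QuasiMultiplicativeShape S₀ FA' := by
  rintro ⟨c, hc, h⟩
  obtain ⟨n, hn⟩ := exists_nat_gt (25 / c)
  have hn0 : (0 : ℝ) < n := lt_trans (by positivity) hn
  set m : ℕ := max n 4 with hm_def
  have hm4 : 4 ≤ m := le_max_right _ _
  have hm1 : 1 ≤ m := le_trans (by norm_num) hm4
  have hnm : (n : ℝ) ≤ m := by exact_mod_cast le_max_left n 4
  have key := h 2 m (by norm_num) (by omega)
  rw [avoid_w (by norm_num), avoid_w hm1, avoid_v hm1 (by norm_num) (by omega)] at key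
  have hq2 : q 2 = 1 / 5 := by rw [q]; norm_num
  rw [hq2] at key
  push_cast at key
  have hq0 := q_pos m
  have hqm : q m < c / 25 := by
    have h1 : q m ≤ (n : ℝ)⁻¹ := by
      rw [q]; exact inv_anti₀ hn0 (by linarith)
    have h2 : (n : ℝ)⁻¹ < c / 25 := by
      rw [div_lt_iff₀ hc] at hn
      rw [inv_lt_iff_one_lt_mul₀ hn0]
      linarith
    exact lt_of_le_of_lt h1 h2
  have hq1 : q m ≤ 1 := (q_le_half hm1).trans (by norm_num)
  -- key : c * (2 * (1/5 * (1/5))) * (2 * (1 - 2⁻¹ * (1 - q m * q m))) ≤ 2 * (q m * q m)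
  nlinarith [mul_pos hc hq0, mul_pos hc (mul_pos hq0 hq0)]

/-- **(d) Targets: quasi-multiplicativity is not soft, even given everything else the line has.**
No argument from the 22-field soft package together with GAP, the isosceles RP minors, the
un-pinched envelope, the single-pinch law and strict single-pinch positivity proves
`QuasiMultiplicative`: family A′ has all of them and violates it. Any proof of stub 4 must use a
property of `criticalCorr 3` beyond these — a genuine lattice coupling between the pinched and the
opened configuration (separation + source-Harnack), exactly as the line card says. [folklore] -/
theorem quasiMultiplicative_false_without_model :
    ¬ ∀ (S : Site 3 → Site 3 → ℝ) (T : Site 3 → ℝ) (F : (Fin 4 → Site 3) → ℝ),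
      SoftPackage S T F → GapShape S T F → RPUnpinchIsoShape S F → UnpinchedEnvelopeShape S T F →
        SinglePinchLawShape S T F → SinglePinchPositiveShape S F → QuasiMultiplicativeShape S F :=
  fun h => not_quasiMultiplicativeShape_A' (h S₀ T₀ FA' softPackage_A' gapShape_A'
    rpUnpinchIsoShape_A' unpinchedEnvelopeShape_A' singlePinchLawShape_A' singlePinchPositiveShape_A')

/-- The witness, packaged: all soft inputs of the line, no quasi-multiplicativity, no far merging. [folklore] -/
theorem lineInputs_without_QM_and_farMerging :
    ∃ (S : Site 3 → Site 3 → ℝ) (T : Site 3 → ℝ) (F : (Fin 4 → Site 3) → ℝ),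
      SoftPackage S T F ∧ GapShape S T F ∧ RPUnpinchIsoShape S F ∧ UnpinchedEnvelopeShape S T F ∧
        SinglePinchLawShape S T F ∧ SinglePinchPositiveShape S F ∧
        ¬ QuasiMultiplicativeShape S F ∧ ¬ FarMergingShape S F :=
  ⟨S₀, T₀, FA', softPackage_A', gapShape_A', rpUnpinchIsoShape_A', unpinchedEnvelopeShape_A',
    singlePinchLawShape_A', singlePinchPositiveShape_A', not_quasiMultiplicativeShape_A',
    not_farMergingShape_A'⟩

end verdicts



end Summit.CriticalPhenomena.Ising3DConformalLimit.Theorems.GapForcesFarMerging.Negative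

end
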